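import Mathlib
import HarnessLib

/-!
# The ordered binomial expansion with central constants, indexed by subsets of `Fin n`
(helper of stub `stub_heavyCalibration`, line `vitali-mass-descent`, crux
`Summit.QuantumFields.QCD.Theses.EulerDescent.RetypedContinuumComplement`, item stmt-QuantumFields-16903)

Pure algebra behind the SCHEME-TRANSFER identity of the lattice QCD `n`-point functions
(`…HeavyCalibrationTransfer`): in a (noncommutative) algebra `A` over a commutative semiring `R`,
the ORDERED product `∏ᵢ (Xᵢ + cᵢ·1)` over `i : Fin n` with central constants `cᵢ ∈ R` expands as the
sum over subsets `B ⊆ Fin n` of `(∏_{i ∉ B} cᵢ) • ∏_{j < |B|} X_{e_B(j)}`, where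
`e_B = B.orderEmbOfFin rfl : Fin |B| ↪o Fin n` enumerates `B` increasingly (`prod_ofFn_add_algebraMap`;
the Grassmann algebra of lattice fermions is not commutative, so Mathlib's `Finset.prod_add` does not
apply, and the sub-products must stay ordered).  Supporting lemmas: the list form over a duplicate-free
index list (`prod_map_add_algebraMap`), `B.sort = (finRange n).filter (· ∈ B)`, the `List.ofFn` along
`orderEmbOfFin`, re-indexing of commutative products along `orderEmbOfFin`, `orderEmbOfFin univ = id`,
and the explicit subset sums over `Fin 1` and `Fin 2` used by the one- and two-point corollaries.
Def-free theorem file. [folklore]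
-/

namespace Summit.QuantumFields.QCD.Cruxes.RetypedContinuumComplement.VitaliMassDescent

open scoped BigOperators

/-- **Ordered binomial expansion over a duplicate-free list.**  For `X : ι → A`, central constants
`c : ι → R` and a list `l` without duplicates,
`∏_{i ∈ l} (Xᵢ + cᵢ) = Σ_{B ⊆ l} (∏_{i ∈ l ∖ B} cᵢ) • ∏_{i ∈ l, i ∈ B} Xᵢ` (ordered products, the
sub-product in the order of `l`). [folklore] -/
theorem prod_map_add_algebraMap {R A : Type*} [CommSemiring R] [Semiring A] [Algebra R A]
    {ι : Type*} [DecidableEq ι] (X : ι → A) (c : ι → R) :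
    ∀ (l : List ι), l.Nodup →
      (l.map fun i => X i + algebraMap R A (c i)).prod =
        ∑ B ∈ l.toFinset.powerset, (∏ i ∈ l.toFinset \ B, c i) • ((l.filter (· ∈ B)).map X).prod
  | [], _ => by simp
  | a :: l, hl => by
    obtain ⟨ha, hl'⟩ := List.nodup_cons.1 hl
    have has : a ∉ l.toFinset := fun h => ha (List.mem_toFinset.1 h)
    rw [List.map_cons, List.prod_cons, prod_map_add_algebraMap X c l hl', List.toFinset_cons,
      Finset.sum_powerset_insert has, add_mul, Finset.mul_sum, Finset.mul_sum, add_comm]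
    congr 1
    · -- subsets avoiding `a`: the constant `c a` is picked up
      refine Finset.sum_congr rfl fun B hB => ?_
      have haB : a ∉ B := fun h => has (Finset.mem_powerset.1 hB h)
      rw [Finset.insert_sdiff_of_notMem _ haB,
        Finset.prod_insert (fun h => has (Finset.sdiff_subset h)),
        List.filter_cons_of_neg (by simpa using haB), Algebra.algebraMap_eq_smul_one, smul_mul_assoc,
        one_mul, smul_smul]
    · -- subsets containing `a`: the factor `X a` is picked up, in front
      refine Finset.sum_congr rfl fun B _ => ?_
      have hfilt : l.filter (· ∈ insert a B) = l.filter (· ∈ B) := by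
        refine List.filter_congr fun i hi => ?_
        have hia : i ≠ a := fun h => ha (h ▸ hi)
        simp [Finset.mem_insert, hia]
      rw [Finset.insert_sdiff_insert, Finset.sdiff_insert_of_notMem has,
        List.filter_cons_of_pos (by simp), hfilt, List.map_cons, List.prod_cons, mul_smul_comm]

/-- The increasing enumeration of `B ⊆ Fin n` is `finRange n` filtered by membership in `B`. [folklore] -/
theorem sort_eq_filter_finRange {n : ℕ} (B : Finset (Fin n)) :
    B.sort (· ≤ ·) = (List.finRange n).filter (· ∈ B) := by
  refine B.sortedLT_sort.eq_of_mem_iff (((List.sortedLT_finRange n).pairwise.filter _).sortedLT) ?_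
  intro i
  simp

/-- `List.ofFn` along `B.orderEmbOfFin` is the `B`-filtered `finRange`, mapped. [folklore] -/
theorem ofFn_comp_orderEmbOfFin {A : Type*} {n : ℕ} (B : Finset (Fin n)) (X : Fin n → A) :
    (List.ofFn fun j : Fin B.card => X (B.orderEmbOfFin rfl j)) =
      ((List.finRange n).filter (· ∈ B)).map X := by
  rw [List.ofFn_eq_map, ← sort_eq_filter_finRange, ← Finset.listMap_orderEmbOfFin_finRange B rfl,
    List.map_map]
  rfl

/-- **Ordered binomial expansion over `Fin n`, indexed by subsets.**  For `X : Fin n → A` and central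
constants `c : Fin n → R`,
`∏ᵢ (Xᵢ + cᵢ) = Σ_{B : Finset (Fin n)} (∏_{i ∈ Bᶜ} cᵢ) • ∏_{j : Fin |B|} X_{e_B j}` with
`e_B = B.orderEmbOfFin rfl` (ordered products). [folklore] -/
theorem prod_ofFn_add_algebraMap {R A : Type*} [CommSemiring R] [Semiring A] [Algebra R A] {n : ℕ}
    (X : Fin n → A) (c : Fin n → R) :
    (List.ofFn fun i => X i + algebraMap R A (c i)).prod =
      ∑ B : Finset (Fin n), (∏ i ∈ Bᶜ, c i) •
        (List.ofFn fun j : Fin B.card => X (B.orderEmbOfFin rfl j)).prod := by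
  rw [List.ofFn_eq_map, prod_map_add_algebraMap X c _ (List.nodup_finRange n), List.toFinset_finRange,
    Finset.powerset_univ]
  refine Finset.sum_congr rfl fun B _ => ?_
  rw [ofFn_comp_orderEmbOfFin, Finset.compl_eq_univ_sdiff]

/-- A commutative product over `B` re-indexed along `B.orderEmbOfFin`. [folklore] -/
theorem prod_orderEmbOfFin {M : Type*} [CommMonoid M] {n : ℕ} (B : Finset (Fin n)) (h : Fin n → M) :
    ∏ j : Fin B.card, h (B.orderEmbOfFin rfl j) = ∏ i ∈ B, h i := by
  conv_rhs => rw [← Finset.map_orderEmbOfFin_univ B rfl]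
  rw [Finset.prod_map]
  rfl

/-- `orderEmbOfFin` of the full set `univ ⊆ Fin n` is the identity. [folklore] -/
theorem orderEmbOfFin_univ_apply {n : ℕ} (h : (Finset.univ : Finset (Fin n)).card = n) (j : Fin n) :
    Finset.univ.orderEmbOfFin h j = j := by
  have := Finset.orderEmbOfFin_unique' h (f := (RelEmbedding.refl (· ≤ ·) : Fin n ↪o Fin n))
    fun _ => Finset.mem_univ _
  exact (congrArg (fun e : Fin n ↪o Fin n => e j) this).symm

/-- Sums over the subsets of a singleton: `∅` and the singleton. [folklore] -/
theorem sum_powerset_singleton {α M : Type*} [DecidableEq α] [AddCommMonoid M] (a : α)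
    (g : Finset α → M) : ∑ B ∈ ({a} : Finset α).powerset, g B = g ∅ + g {a} := by
  rw [← Finset.insert_empty, Finset.sum_powerset_insert (Finset.notMem_empty a), Finset.powerset_empty,
    Finset.sum_singleton, Finset.sum_singleton, Finset.insert_empty]

/-- Sums over the subsets of `Fin 1`: `∅` and `univ`. [folklore] -/
theorem sum_finset_fin_one {M : Type*} [AddCommMonoid M] (g : Finset (Fin 1) → M) :
    ∑ B : Finset (Fin 1), g B = g ∅ + g Finset.univ := by
  rw [← Finset.powerset_univ, Finset.univ_unique, sum_powerset_singleton]

/-- Sums over the subsets of `Fin 2`: `∅`, `{1}`, `{0}` and `univ`. [folklore] -/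
theorem sum_finset_fin_two {M : Type*} [AddCommMonoid M] (g : Finset (Fin 2) → M) :
    ∑ B : Finset (Fin 2), g B = g ∅ + g {1} + (g {0} + g Finset.univ) := by
  have huniv : (Finset.univ : Finset (Fin 2)) = insert 0 {1} := by decide
  rw [← Finset.powerset_univ, huniv, Finset.sum_powerset_insert (by decide), sum_powerset_singleton,
    sum_powerset_singleton, Finset.insert_empty]

/-- The complements of the singletons of `Fin 2`. [folklore] -/
theorem compl_singleton_fin_two :
    (({0} : Finset (Fin 2))ᶜ) = {1} ∧ (({1} : Finset (Fin 2))ᶜ) = {0} := by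
  decide

end Summit.QuantumFields.QCD.Cruxes.RetypedContinuumComplement.VitaliMassDescent
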